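import Summits.NavierStokesRegularity.NavierStokesRegularity.Theses.HardyPointSink
import Summits.NavierStokesRegularity.NavierStokesRegularity.Theorems.HardyPointSinkHardyEnergyBoundHardyDissipationCriterion
import Summits.NavierStokesRegularity.NavierStokesRegularity.Theorems.CertifiedBlowupCertifiedBlowupAxisymBlowupTopHigherRegularity
import Summits.NavierStokesRegularity.NavierStokesRegularity.Theorems.HardyPointSinkHardyEnergyBoundNecessity
import Literature.Analysis.FluidPDE.NSBoundedHigherRegularity
import Literature.Analysis.FluidPDE.KNSSNoAxisymmetricTypeIHolds
import Literature.Analysis.FluidPDE.LocalLerayCylinderSliceNorms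
import HarnessLib

/-!
# Route HardyPointSink — crux `HardyEnergyBound` (item stmt-NavierStokesRegularity-7979):
# at a REGULAR point of the final time the Hardy dissipation at the centre is finite

Support file (theorems only, `--supports stmt-NavierStokesRegularity-7979`; lead c7 of the crux
line, 2026-08-17).  The dissipative currency of the route's point-sink ledger is the **Hardy
dissipation** `∫∫ |∇u|²/|x − x₀|` at the sink `x₀`.  Lead c6 proved
(`HardyPointSinkHardyEnergyBoundHardyDissipationCriterion.lean`) that it is INFINITE on every box
at a point where `u` is unbounded near `(T, x₀)`.  This file proves the converse half, so that the
points of the final time are classified EXACTLY by the dissipative currency: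

* `iteratedFDeriv_bounded_near_top_of_isBoundedNearTop_strip` — in the strip frame (suitable
  weak `(u, p)` on `(0, T) × ℝ³` with viscosity `ν > 0`, `u` smooth inside, local energy classes
  reaching the final time), boundedness of `u` near `(T, x₀)` upgrades to boundedness of EVERY
  spatial derivative `Dⁿu` on a backward parabolic neighbourhood of `(T, x₀)`: the
  viscosity-normalising zoom `v = (R/ν) u(T + (R²/ν)s, x₀ + Ry)` is a bounded distributional
  solution of the unit-viscosity system on `Q(0, 1)` with `L^{3/2}` pressure, and the higher
  interior regularity of bounded solutions (`NSBoundedHigherRegularity_holds`, Seregin–Šverák 2009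
  §2 p. 8, PROVED in the tree) bounds all derivatives on `Q(0, 1/2)`; unscaling as in
  `CertifiedBlowupAxisymBlowup.CompactAmplification.exists_bound_iteratedFDeriv_of_rescaled`.
* `hardyDissipation_lt_top_of_isBoundedNearTop` — hence the Hardy dissipation at the centre is
  FINITE on some box `(T − r², T) × B(x₀, r)`: `|∇u|² ≤ G²` there and `∫_{B(x₀,r)} dx/|x − x₀| < ∞`.
* `isBoundedNearTop_iff_exists_hardyDissipation_lt_top` — with c6's criterion: **`u` is bounded
  near `(T, x₀)` iff the Hardy dissipation at `x₀` is finite on some box** (negative form: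
  `not_isBoundedNearTop_iff_forall_hardyDissipation_eq_top`).

References: G. Seregin, V. Šverák, Comm. PDE 34 (2009) = arXiv:0804.1803, §2 p. 8
[SereginSverak2009]; G. Seregin, *Lecture Notes on Regularity Theory for the Navier–Stokes
Equations* (2014), Ch. 6, Thm. 1.4 [Seregin2014].
-/

-- the problem directory repeats the summit name (D-0017); core's `dupNamespace` linter fires
set_option linter.dupNamespace false

noncomputable section

open Set MeasureTheory Filter Topology TopologicalSpace Function Metric Module
open scoped ENNReal NNReal
open Literature.Analysis.FluidPDE Literature.Analysis.FunctionSpaces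

namespace Summit.NavierStokesRegularity.NavierStokesRegularity.Theorems

open CertifiedBlowupAxisymBlowup.CompactAmplification

/-! ### Higher regularity at a regular point of the final time (strip frame) -/

/-- **Bounded near `(T, x₀)` ⇒ every spatial derivative bounded near `(T, x₀)`** (strip frame).
For a suitable weak solution `(u, p)` of the unforced Navier–Stokes equations (viscosity `ν > 0`)
on the open strip `(0, T) × ℝ³`, `u` smooth there, whose local energy classes reach the final
time on every `(t₁, T) × B_ρ(0)`, and a point `x₀` near which `u` is bounded up to the final time
(`IsBoundedNearTop u T x₀`): for every order `n` there are `r > 0` and `K` with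
`‖Dⁿu(t)(x)‖ ≤ K` for `T − r² < t < T`, `x ∈ B(x₀, r)`.  Proof: zoom to unit viscosity about
`(T, x₀)` (`IsSuitableWeakSolutionOn.stRescale`) at a scale `R` whose `ν`-cylinder lies in the
region of boundedness and in `(T/2, T) × B(0, ‖x₀‖ + r₀)`; `NSBoundedHigherRegularity_holds`
gives a representative with uniformly Hölder, hence bounded, derivatives on `Q(0, 1/2)`, equal to
the continuous zoom everywhere on `Q(0, 1)`; unscale (`exists_bound_iteratedFDeriv_of_rescaled`).
[cite: SereginSverak2009, §2 p. 8 (∇ᵏv Hölder continuous under (b8)–(b10))] -/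
theorem iteratedFDeriv_bounded_near_top_of_isBoundedNearTop_strip {ν T : ℝ} (hν : 0 < ν) (hT : 0 < T)
    {u : ℝ → (EuclideanSpace ℝ (Fin 3)) → (EuclideanSpace ℝ (Fin 3))}
    {p : ℝ → (EuclideanSpace ℝ (Fin 3)) → ℝ}
    (hsm : ContDiffOn ℝ (⊤ : ℕ∞) (uncurry u) (Ioo 0 T ×ˢ univ))
    (hsw : IsSuitableWeakSolutionOn (slab (EuclideanSpace ℝ (Fin 3)) (Ioo 0 T) isOpen_Ioo) ν 0 u p)
    (hloc : ∀ t₁ ∈ Ioo 0 T, ∀ ρ : ℝ, 0 < ρ →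
      (∃ C : ℝ≥0, ∀ t ∈ Ioo t₁ T,
          ∫⁻ x in ball (0 : (EuclideanSpace ℝ (Fin 3))) ρ, ‖u t x‖ₑ ^ 2 ≤ C) ∧
      (∫⁻ z in Ioo t₁ T ×ˢ ball (0 : (EuclideanSpace ℝ (Fin 3))) ρ,
          ENNReal.ofReal (frobeniusNormSq (fderiv ℝ (u z.1) z.2)) < ∞) ∧
      (∫⁻ z in Ioo t₁ T ×ˢ ball (0 : (EuclideanSpace ℝ (Fin 3))) ρ,
          ‖p z.1 z.2‖ₑ ^ (3 / 2 : ℝ) < ∞))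
    {x₀ : (EuclideanSpace ℝ (Fin 3))} (hbd : IsBoundedNearTop u T x₀) (n : ℕ) :
    ∃ r > 0, ∃ K : ℝ, ∀ t ∈ Ioo (T - r ^ 2) T, ∀ x ∈ ball x₀ r,
      ‖iteratedFDeriv ℝ n (u t) x‖ ≤ K := by
  obtain ⟨r₀, hr₀, K₀, hK₀⟩ := hbd
  -- ### the local classes on `(T/2, T) × B(0, ϱ)`, `ϱ = ‖x₀‖ + r₀`
  set ϱ : ℝ := ‖x₀‖ + r₀ with hϱ
  obtain ⟨-, -, hP⟩ := hloc (T / 2) ⟨by linarith, by linarith⟩ ϱ (by positivity)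
  have hballϱ : ∀ s : ℝ, s ≤ r₀ → ball x₀ s ⊆ ball (0 : (EuclideanSpace ℝ (Fin 3))) ϱ := by
    intro s hs x hx
    rw [mem_ball, dist_eq_norm] at hx
    rw [mem_ball_zero_iff, ← sub_add_cancel x x₀]
    exact (norm_add_le _ _).trans_lt (by rw [hϱ]; linarith)
  have hhalf : Ioo (T / 2) T ×ˢ ball (0 : (EuclideanSpace ℝ (Fin 3))) ϱ ⊆
      Ioo 0 T ×ˢ (univ : Set (EuclideanSpace ℝ (Fin 3))) :=
    prod_mono (Ioo_subset_Ioo_left (by linarith)) (subset_univ _)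
  -- ### the scale: `0 < R ≤ r₀`, `R²/ν ≤ m := min (r₀²) (T/2)`
  set m : ℝ := min (r₀ ^ 2) (T / 2) with hm
  have hmpos : 0 < m := lt_min (by positivity) (by linarith)
  have hmr : m ≤ r₀ ^ 2 := min_le_left _ _
  have hmT : m ≤ T / 2 := min_le_right _ _
  set R : ℝ := min r₀ (Real.sqrt (ν * m)) with hR
  have hRpos : 0 < R := lt_min hr₀ (Real.sqrt_pos.2 (by positivity))
  have hRr₀ : R ≤ r₀ := min_le_left _ _
  have hRm : R ^ 2 / ν ≤ m := by
    have h2 := pow_le_pow_left₀ hRpos.le (min_le_right _ _ : R ≤ Real.sqrt (ν * m)) 2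
    rw [Real.sq_sqrt (by positivity)] at h2
    rw [div_le_iff₀ hν]
    linarith
  set α : ℝ := R / ν with hα
  set β : ℝ := R ^ 2 / ν with hβdef
  have hαpos : 0 < α := by positivity
  have hβpos : 0 < β := by positivity
  have hβeq : β = α * R := by rw [hβdef, hα]; field_simp
  have hβr₀ : β ≤ r₀ ^ 2 := hRm.trans hmr
  have hβT : β ≤ T / 2 := hRm.trans hmT
  -- ### the `ν`-cylinder `PO = (T - β, T) × B(x₀, R)`: in the region of boundedness, in
  -- `(T/2, T) × B(0, ϱ)`, in the strip
  set PO : Opens (ℝ × (EuclideanSpace ℝ (Fin 3))) :=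
    ⟨Ioo (T - β) T ×ˢ ball x₀ R, isOpen_Ioo.prod isOpen_ball⟩ with hPO
  have hPObd : ∀ z ∈ (PO : Set (ℝ × (EuclideanSpace ℝ (Fin 3)))), ‖u z.1 z.2‖ ≤ K₀ := by
    rintro ⟨t, x⟩ ⟨ht, hx⟩
    exact hK₀ t ⟨by linarith [ht.1], ht.2⟩ x (ball_subset_ball hRr₀ hx)
  have hPOsub : (PO : Set (ℝ × (EuclideanSpace ℝ (Fin 3)))) ⊆
      Ioo (T / 2) T ×ˢ ball (0 : (EuclideanSpace ℝ (Fin 3))) ϱ :=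
    prod_mono (Ioo_subset_Ioo_left (by linarith)) (hballϱ R hRr₀)
  have hPOslab : (PO : Set (ℝ × (EuclideanSpace ℝ (Fin 3)))) ⊆
      Ioo 0 T ×ˢ (univ : Set (EuclideanSpace ℝ (Fin 3))) := hPOsub.trans hhalf
  have hPOle : PO ≤ slab (EuclideanSpace ℝ (Fin 3)) (Ioo 0 T) isOpen_Ioo := fun z hz => hPOslab hz
  -- ### `Φ⁻¹(PO) = Q(0, 1)` and the rescaled pair
  have hpre1 : stPreimage β R T x₀ PO =
      parabolicCylinderOpens 1 (0 : ℝ × (EuclideanSpace ℝ (Fin 3))) := by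
    apply Opens.ext
    rw [coe_stPreimage]
    have h := stAffine_preimage_cylinder_eq_parabolicCylinder hν hRpos T x₀ R
    rw [div_self hRpos.ne'] at h
    exact h
  have hQ1 : parabolicCylinder 1 (0 : ℝ × (EuclideanSpace ℝ (Fin 3))) =
      stAffine β R T x₀ ⁻¹' (PO : Set (ℝ × (EuclideanSpace ℝ (Fin 3)))) := by
    rw [← coe_stPreimage, hpre1]; rfl
  have hsuit1 : IsSuitableWeakSolutionOn
      (parabolicCylinderOpens 1 (0 : ℝ × (EuclideanSpace ℝ (Fin 3)))) 1 0
      (α • stPull β R T x₀ u) (α ^ 2 • stPull β R T x₀ p) := by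
    have h0 := (hsw.of_le hPOle).stRescale hαpos hRpos hβeq T x₀
    have hvisc : α * ν / R = 1 := by
      rw [hα, div_mul_cancel₀ R hν.ne', div_self hRpos.ne']
    have hforce : ((α ^ 2 * R) • stPull β R T x₀
        (0 : ℝ → (EuclideanSpace ℝ (Fin 3)) → (EuclideanSpace ℝ (Fin 3)))) = 0 := by
      funext s y; simp [stPull]
    rw [hvisc, hforce, hpre1] at h0
    exact h0
  -- the bound `|v| ≤ α K₀` on `Q(0, 1)` (everywhere, hence a.e.)
  have hbd1 : ∀ᵐ w ∂(volume.restrict (parabolicCylinder 1 (0 : ℝ × (EuclideanSpace ℝ (Fin 3))))),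
      ‖(α • stPull β R T x₀ u) w.1 w.2‖ ≤ α * K₀ := by
    refine (ae_restrict_mem (isOpen_parabolicCylinder 1 _).measurableSet).mono fun w hw => ?_
    rw [hQ1] at hw
    have h := hPObd _ hw
    rw [stAffine_fst, stAffine_snd] at h
    rw [smul_stPull_apply, norm_smul, Real.norm_of_nonneg hαpos.le]
    exact mul_le_mul_of_nonneg_left h hαpos.le
  -- `π ∈ L^{3/2}(Q(0, 1))`
  have hp1 : ∫⁻ w in parabolicCylinder 1 (0 : ℝ × (EuclideanSpace ℝ (Fin 3))),
      ‖(α ^ 2 • stPull β R T x₀ p) w.1 w.2‖ₑ ^ (3 / 2 : ℝ) < ∞ := by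
    rw [hQ1, setLIntegral_enorm_rpow_stRescale hβpos hRpos T x₀ (α ^ 2) p _ (by norm_num)]
    refine ENNReal.mul_lt_top (ENNReal.mul_lt_top
      (ENNReal.rpow_lt_top_of_nonneg (by norm_num) enorm_ne_top) ENNReal.ofReal_lt_top) ?_
    exact lt_of_le_of_lt (lintegral_mono_set hPOsub) hP
  -- ### higher interior regularity of bounded distributional solutions
  obtain ⟨V, hae, -, hHol⟩ := NSBoundedHigherRegularity_holds _ _
    (0 : ℝ × (EuclideanSpace ℝ (Fin 3))) 1 (α * K₀) hsuit1.distributional hbd1 hp1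
  -- both the zoom and its smooth representative are continuous on `Q(0, 1)`, so they agree there
  have hVc : ContinuousOn (uncurry V) (parabolicCylinder 1 (0 : ℝ × (EuclideanSpace ℝ (Fin 3)))) :=
    continuousOn_uncurry_of_holder_exhaustion (hHol 0)
  have hvc : ContinuousOn (uncurry (α • stPull β R T x₀ u))
      (parabolicCylinder 1 (0 : ℝ × (EuclideanSpace ℝ (Fin 3)))) := by
    have hmaps : MapsTo (stAffine β R T x₀)
        (parabolicCylinder 1 (0 : ℝ × (EuclideanSpace ℝ (Fin 3))))
        (Ioo 0 T ×ˢ (univ : Set (EuclideanSpace ℝ (Fin 3)))) := by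
      intro w hw
      rw [hQ1] at hw
      exact hPOslab hw
    have h1 : ContinuousOn (fun w => uncurry u (stAffine β R T x₀ w))
        (parabolicCylinder 1 (0 : ℝ × (EuclideanSpace ℝ (Fin 3)))) :=
      hsm.continuousOn.comp (continuous_stAffine β R T x₀).continuousOn hmaps
    exact h1.const_smul α
  have heq : EqOn (uncurry (α • stPull β R T x₀ u)) (uncurry V)
      (parabolicCylinder 1 (0 : ℝ × (EuclideanSpace ℝ (Fin 3)))) :=
    Measure.eqOn_open_of_ae_eq hae (isOpen_parabolicCylinder 1 _) hvc hVc
  -- the Hölder bound on `Q(0, 1/2)` for `DⁿV`, transferred to the zoom, gives the bound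
  obtain ⟨C, a, -, hC⟩ := hHol n (1 / 2) ⟨by norm_num, by norm_num⟩
  have hsub : parabolicCylinder (1 / 2) (0 : ℝ × (EuclideanSpace ℝ (Fin 3))) ⊆
      parabolicCylinder 1 (0 : ℝ × (EuclideanSpace ℝ (Fin 3))) := by
    intro w hw
    rw [mem_parabolicCylinder_zero_iff] at hw ⊢
    exact ⟨⟨by nlinarith [hw.1.1], hw.1.2⟩, hw.2.trans (by norm_num)⟩
  obtain ⟨K', hK'⟩ := exists_forall_norm_le_of_holderOnWith_half
    (holderOnWith_iteratedFDeriv_of_eqOn (isOpen_parabolicCylinder 1 _) heq n hsub hC)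
  exact exists_bound_iteratedFDeriv_of_rescaled hν hRpos hK'

/-- **Bounded near `(T, x₀)` ⇒ gradient bounded near `(T, x₀)`** (strip frame): the case `n = 1`
of `iteratedFDeriv_bounded_near_top_of_isBoundedNearTop_strip`, stated for `fderiv`
(`‖D¹f(x)‖ = ‖fderiv f x‖`). [cite: SereginSverak2009, §2 p. 8] -/
theorem fderiv_bounded_near_top_of_isBoundedNearTop_strip {ν T : ℝ} (hν : 0 < ν) (hT : 0 < T)
    {u : ℝ → (EuclideanSpace ℝ (Fin 3)) → (EuclideanSpace ℝ (Fin 3))}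
    {p : ℝ → (EuclideanSpace ℝ (Fin 3)) → ℝ}
    (hsm : ContDiffOn ℝ (⊤ : ℕ∞) (uncurry u) (Ioo 0 T ×ˢ univ))
    (hsw : IsSuitableWeakSolutionOn (slab (EuclideanSpace ℝ (Fin 3)) (Ioo 0 T) isOpen_Ioo) ν 0 u p)
    (hloc : ∀ t₁ ∈ Ioo 0 T, ∀ ρ : ℝ, 0 < ρ →
      (∃ C : ℝ≥0, ∀ t ∈ Ioo t₁ T,
          ∫⁻ x in ball (0 : (EuclideanSpace ℝ (Fin 3))) ρ, ‖u t x‖ₑ ^ 2 ≤ C) ∧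
      (∫⁻ z in Ioo t₁ T ×ˢ ball (0 : (EuclideanSpace ℝ (Fin 3))) ρ,
          ENNReal.ofReal (frobeniusNormSq (fderiv ℝ (u z.1) z.2)) < ∞) ∧
      (∫⁻ z in Ioo t₁ T ×ˢ ball (0 : (EuclideanSpace ℝ (Fin 3))) ρ,
          ‖p z.1 z.2‖ₑ ^ (3 / 2 : ℝ) < ∞))
    {x₀ : (EuclideanSpace ℝ (Fin 3))} (hbd : IsBoundedNearTop u T x₀) :
    ∃ r > 0, ∃ K : ℝ, ∀ t ∈ Ioo (T - r ^ 2) T, ∀ x ∈ ball x₀ r, ‖fderiv ℝ (u t) x‖ ≤ K := by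
  obtain ⟨r, hr, K, hK⟩ :=
    iteratedFDeriv_bounded_near_top_of_isBoundedNearTop_strip hν hT hsm hsw hloc hbd 1
  refine ⟨r, hr, K, fun t ht x hx => ?_⟩
  have h := hK t ht x hx
  rwa [norm_iteratedFDeriv_one] at h

/-! ### Finite Hardy dissipation at a regular point of the final time -/

/-- **A bounded gradient on a box has finite Hardy dissipation at every sink of the ball.**  If
`‖∇u(t)(x)‖ ≤ G` for `t ∈ (a, b)`, `x ∈ B(c, r)`, then for every sink `x₀`,
`∫∫_{(a,b)×B(c,r)} |∇u|²_F/|x − x₀| ≤ (b − a) · 3G² · (5/2)|B₁| r² < ∞` (Tonelli's inequality,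
`|∇u|²_F ≤ 3‖∇u‖²` (`frobeniusNormSq_le_three_mul_norm_sq`), and the Newtonian potential of the ball
`hardyEnergyBound_necessity_lintegral_inv_enorm_le`). [folklore] -/
theorem hardyDissipation_lt_top_of_forall_fderiv_le
    {u : ℝ → (EuclideanSpace ℝ (Fin 3)) → (EuclideanSpace ℝ (Fin 3))} {a b r G : ℝ}
    {c : EuclideanSpace ℝ (Fin 3)} (hr : 0 < r)
    (hG : ∀ t ∈ Ioo a b, ∀ x ∈ ball c r, ‖fderiv ℝ (u t) x‖ ≤ G) (x₀ : EuclideanSpace ℝ (Fin 3)) :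
    ∫⁻ z in Ioo a b ×ˢ ball c r,
      ENNReal.ofReal (frobeniusNormSq (fderiv ℝ (u z.1) z.2)) / ‖z.2 - x₀‖ₑ < ∞ := by
  set K : ℝ≥0∞ := ENNReal.ofReal (3 * G ^ 2) *
    ENNReal.ofReal (5 / 2 * (volume : Measure (EuclideanSpace ℝ (Fin 3))).real (ball 0 1) * r ^ 2)
    with hK
  have hKtop : K ≠ ∞ := ENNReal.mul_ne_top ENNReal.ofReal_ne_top ENNReal.ofReal_ne_top
  -- pointwise domination on the box
  have hpt : ∀ z ∈ Ioo a b ×ˢ ball c r,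
      ENNReal.ofReal (frobeniusNormSq (fderiv ℝ (u z.1) z.2)) / ‖z.2 - x₀‖ₑ ≤
        ENNReal.ofReal (3 * G ^ 2) * (‖z.2 - x₀‖ₑ)⁻¹ := by
    rintro ⟨t, x⟩ ⟨ht, hx⟩
    rw [div_eq_mul_inv]
    gcongr
    calc frobeniusNormSq (fderiv ℝ (u t) x) ≤ 3 * ‖fderiv ℝ (u t) x‖ ^ 2 :=
          frobeniusNormSq_le_three_mul_norm_sq _
      _ ≤ 3 * G ^ 2 := by
          have h := hG t ht x hx
          have h0 : 0 ≤ ‖fderiv ℝ (u t) x‖ := norm_nonneg _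
          nlinarith
  -- Tonelli's inequality and the Newtonian potential of the ball
  calc ∫⁻ z in Ioo a b ×ˢ ball c r,
        ENNReal.ofReal (frobeniusNormSq (fderiv ℝ (u z.1) z.2)) / ‖z.2 - x₀‖ₑ
      ≤ ∫⁻ z in Ioo a b ×ˢ ball c r, ENNReal.ofReal (3 * G ^ 2) * (‖z.2 - x₀‖ₑ)⁻¹ :=
        setLIntegral_mono' (measurableSet_Ioo.prod measurableSet_ball) hpt
    _ ≤ ∫⁻ _s in Ioo a b, ∫⁻ x in ball c r, ENNReal.ofReal (3 * G ^ 2) * (‖x - x₀‖ₑ)⁻¹ := by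
        rw [Measure.volume_eq_prod, ← Measure.prod_restrict]
        exact lintegral_prod_le _
    _ ≤ ∫⁻ _s in Ioo a b, K := by
        refine lintegral_mono fun s => ?_
        rw [lintegral_const_mul' _ _ ENNReal.ofReal_ne_top, hK]
        gcongr
        exact hardyEnergyBound_necessity_lintegral_inv_enorm_le x₀ c hr
    _ = K * volume (Ioo a b) := setLIntegral_const _ _
    _ < ∞ := ENNReal.mul_lt_top hKtop.lt_top (by rw [Real.volume_Ioo]; exact ENNReal.ofReal_lt_top)

/-- **Bounded near `(T, x₀)` ⇒ the Hardy dissipation at the centre is finite on a box** (strip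
frame): there is `r > 0` with `∫∫_{(T−r²,T)×B(x₀,r)} |∇u|²_F/|x − x₀| < ∞`
(`fderiv_bounded_near_top_of_isBoundedNearTop_strip` and
`hardyDissipation_lt_top_of_forall_fderiv_le`).  Converse of lead c6's
`hardyDissipation_eq_top_of_not_isBoundedNearTop`. [cite: SereginSverak2009, §2 p. 8] -/
theorem hardyDissipation_lt_top_of_isBoundedNearTop {ν T : ℝ} (hν : 0 < ν) (hT : 0 < T)
    {u : ℝ → (EuclideanSpace ℝ (Fin 3)) → (EuclideanSpace ℝ (Fin 3))}
    {p : ℝ → (EuclideanSpace ℝ (Fin 3)) → ℝ}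
    (hsm : ContDiffOn ℝ (⊤ : ℕ∞) (uncurry u) (Ioo 0 T ×ˢ univ))
    (hsw : IsSuitableWeakSolutionOn (slab (EuclideanSpace ℝ (Fin 3)) (Ioo 0 T) isOpen_Ioo) ν 0 u p)
    (hloc : ∀ t₁ ∈ Ioo 0 T, ∀ ρ : ℝ, 0 < ρ →
      (∃ C : ℝ≥0, ∀ t ∈ Ioo t₁ T,
          ∫⁻ x in ball (0 : (EuclideanSpace ℝ (Fin 3))) ρ, ‖u t x‖ₑ ^ 2 ≤ C) ∧
      (∫⁻ z in Ioo t₁ T ×ˢ ball (0 : (EuclideanSpace ℝ (Fin 3))) ρ,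
          ENNReal.ofReal (frobeniusNormSq (fderiv ℝ (u z.1) z.2)) < ∞) ∧
      (∫⁻ z in Ioo t₁ T ×ˢ ball (0 : (EuclideanSpace ℝ (Fin 3))) ρ,
          ‖p z.1 z.2‖ₑ ^ (3 / 2 : ℝ) < ∞))
    {x₀ : (EuclideanSpace ℝ (Fin 3))} (hbd : IsBoundedNearTop u T x₀) :
    ∃ r > 0, ∫⁻ z in Ioo (T - r ^ 2) T ×ˢ ball x₀ r,
      ENNReal.ofReal (frobeniusNormSq (fderiv ℝ (u z.1) z.2)) / ‖z.2 - x₀‖ₑ < ∞ := by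
  obtain ⟨r, hr, G, hG⟩ := fderiv_bounded_near_top_of_isBoundedNearTop_strip hν hT hsm hsw hloc hbd
  exact ⟨r, hr, hardyDissipation_lt_top_of_forall_fderiv_le hr hG x₀⟩

/-- **The points of the final time are classified by the Hardy dissipation at the centre**
(strip frame: suitable weak `(u, p)` on `(0, T) × ℝ³`, viscosity `ν > 0`, `u` smooth inside,
local energy classes reaching the final time): `u` is bounded near `(T, x₀)` **iff** the Hardy
dissipation `∫∫_{(T−δ,T)×B(x₀,ρ₀)} |∇u|²_F/|x − x₀|` is finite on SOME box (`→`: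
`hardyDissipation_lt_top_of_isBoundedNearTop`; `←`: lead c6's
`isBoundedNearTop_of_hardyDissipation_lt_top`, Seregin's backward ε-regularity criterion along the
ν-zoom). [cite: Seregin2014, Ch. 6 §6.1 Theorem 1.4, PDF p. 94] -/
theorem isBoundedNearTop_iff_exists_hardyDissipation_lt_top {ν T : ℝ} (hν : 0 < ν) (hT : 0 < T)
    {u : ℝ → (EuclideanSpace ℝ (Fin 3)) → (EuclideanSpace ℝ (Fin 3))}
    {p : ℝ → (EuclideanSpace ℝ (Fin 3)) → ℝ}
    (hsm : ContDiffOn ℝ (⊤ : ℕ∞) (uncurry u) (Ioo 0 T ×ˢ univ))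
    (hsw : IsSuitableWeakSolutionOn (slab (EuclideanSpace ℝ (Fin 3)) (Ioo 0 T) isOpen_Ioo) ν 0 u p)
    (hloc : ∀ t₁ ∈ Ioo 0 T, ∀ ρ : ℝ, 0 < ρ →
      (∃ C : ℝ≥0, ∀ t ∈ Ioo t₁ T,
          ∫⁻ x in ball (0 : (EuclideanSpace ℝ (Fin 3))) ρ, ‖u t x‖ₑ ^ 2 ≤ C) ∧
      (∫⁻ z in Ioo t₁ T ×ˢ ball (0 : (EuclideanSpace ℝ (Fin 3))) ρ,
          ENNReal.ofReal (frobeniusNormSq (fderiv ℝ (u z.1) z.2)) < ∞) ∧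
      (∫⁻ z in Ioo t₁ T ×ˢ ball (0 : (EuclideanSpace ℝ (Fin 3))) ρ,
          ‖p z.1 z.2‖ₑ ^ (3 / 2 : ℝ) < ∞))
    (x₀ : (EuclideanSpace ℝ (Fin 3))) :
    IsBoundedNearTop u T x₀ ↔
      ∃ δ > 0, ∃ ρ₀ > 0, ∫⁻ z in Ioo (T - δ) T ×ˢ ball x₀ ρ₀,
        ENNReal.ofReal (frobeniusNormSq (fderiv ℝ (u z.1) z.2)) / ‖z.2 - x₀‖ₑ < ∞ := by
  constructor
  · intro hbd
    obtain ⟨r, hr, hfin⟩ := hardyDissipation_lt_top_of_isBoundedNearTop hν hT hsm hsw hloc hbd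
    exact ⟨r ^ 2, by positivity, r, hr, hfin⟩
  · rintro ⟨δ, hδ, ρ₀, hρ₀, hW⟩
    exact isBoundedNearTop_of_hardyDissipation_lt_top hν hT hsm hsw hloc x₀ hδ hρ₀ hW

/-- **Negative form of the classification**: in the strip frame, `u` is NOT bounded near `(T, x₀)`
iff the Hardy dissipation at the centre is INFINITE on EVERY box `(T−δ, T) × B(x₀, ρ₀)`.
[cite: Seregin2014, Ch. 6 §6.1 Theorem 1.4, PDF p. 94] -/
theorem not_isBoundedNearTop_iff_forall_hardyDissipation_eq_top {ν T : ℝ} (hν : 0 < ν)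
    (hT : 0 < T)
    {u : ℝ → (EuclideanSpace ℝ (Fin 3)) → (EuclideanSpace ℝ (Fin 3))}
    {p : ℝ → (EuclideanSpace ℝ (Fin 3)) → ℝ}
    (hsm : ContDiffOn ℝ (⊤ : ℕ∞) (uncurry u) (Ioo 0 T ×ˢ univ))
    (hsw : IsSuitableWeakSolutionOn (slab (EuclideanSpace ℝ (Fin 3)) (Ioo 0 T) isOpen_Ioo) ν 0 u p)
    (hloc : ∀ t₁ ∈ Ioo 0 T, ∀ ρ : ℝ, 0 < ρ →
      (∃ C : ℝ≥0, ∀ t ∈ Ioo t₁ T,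
          ∫⁻ x in ball (0 : (EuclideanSpace ℝ (Fin 3))) ρ, ‖u t x‖ₑ ^ 2 ≤ C) ∧
      (∫⁻ z in Ioo t₁ T ×ˢ ball (0 : (EuclideanSpace ℝ (Fin 3))) ρ,
          ENNReal.ofReal (frobeniusNormSq (fderiv ℝ (u z.1) z.2)) < ∞) ∧
      (∫⁻ z in Ioo t₁ T ×ˢ ball (0 : (EuclideanSpace ℝ (Fin 3))) ρ,
          ‖p z.1 z.2‖ₑ ^ (3 / 2 : ℝ) < ∞))
    (x₀ : (EuclideanSpace ℝ (Fin 3))) :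
    ¬ IsBoundedNearTop u T x₀ ↔
      ∀ δ : ℝ, 0 < δ → ∀ ρ₀ : ℝ, 0 < ρ₀ → ∫⁻ z in Ioo (T - δ) T ×ˢ ball x₀ ρ₀,
        ENNReal.ofReal (frobeniusNormSq (fderiv ℝ (u z.1) z.2)) / ‖z.2 - x₀‖ₑ = ∞ := by
  rw [isBoundedNearTop_iff_exists_hardyDissipation_lt_top hν hT hsm hsw hloc x₀]
  constructor
  · intro h δ hδ ρ₀ hρ₀
    by_contra hne
    exact h ⟨δ, hδ, ρ₀, hρ₀, lt_top_iff_ne_top.2 hne⟩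
  · rintro h ⟨δ, hδ, ρ₀, hρ₀, hfin⟩
    exact hfin.ne (h δ hδ ρ₀ hρ₀)

/-! ### Registered anchor (pure `∀` form, fully qualified) -/

/-- **Anchor `hardyEnergyBound_isBoundedNearTop_iff_hardyDissipation` (lead c7, `--supports
stmt-NavierStokesRegularity-7979`):** in the strip frame, `u` is bounded near `(T, x₀)` iff
`∫∫_{(T−δ,T)×B(x₀,ρ₀)} |∇u|²_F/|x − x₀| < ∞` for some `δ, ρ₀ > 0`
(`isBoundedNearTop_iff_exists_hardyDissipation_lt_top`).
[cite: Seregin2014, Ch. 6 §6.1 Theorem 1.4, PDF p. 94] [cite: SereginSverak2009, §2 p. 8] -/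
theorem hardyEnergyBound_isBoundedNearTop_iff_hardyDissipation :
    ∀ ν : ℝ, 0 < ν → ∀ T : ℝ, 0 < T →
      ∀ (u : ℝ → EuclideanSpace ℝ (Fin 3) → EuclideanSpace ℝ (Fin 3))
        (p : ℝ → EuclideanSpace ℝ (Fin 3) → ℝ),
      ContDiffOn ℝ (⊤ : ℕ∞) (Function.uncurry u) (Set.Ioo 0 T ×ˢ Set.univ) →
      Literature.Analysis.FluidPDE.IsSuitableWeakSolutionOn
        (Literature.Analysis.FluidPDE.slab (EuclideanSpace ℝ (Fin 3)) (Set.Ioo 0 T) isOpen_Ioo)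
        ν 0 u p →
      (∀ t₁ ∈ Set.Ioo 0 T, ∀ ρ : ℝ, 0 < ρ →
        (∃ C : NNReal, ∀ t ∈ Set.Ioo t₁ T,
            ∫⁻ x in Metric.ball (0 : EuclideanSpace ℝ (Fin 3)) ρ, ‖u t x‖ₑ ^ 2 ≤ C) ∧
        (∫⁻ z in Set.Ioo t₁ T ×ˢ Metric.ball (0 : EuclideanSpace ℝ (Fin 3)) ρ,
            ENNReal.ofReal (Literature.Analysis.FluidPDE.frobeniusNormSq (fderiv ℝ (u z.1) z.2))
              < ⊤) ∧
        (∫⁻ z in Set.Ioo t₁ T ×ˢ Metric.ball (0 : EuclideanSpace ℝ (Fin 3)) ρ,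
            ‖p z.1 z.2‖ₑ ^ (3 / 2 : ℝ) < ⊤)) →
      ∀ x₀ : EuclideanSpace ℝ (Fin 3),
        (Literature.Analysis.FluidPDE.IsBoundedNearTop u T x₀ ↔
          ∃ δ > 0, ∃ ρ₀ > 0,
            ∫⁻ z in Set.Ioo (T - δ) T ×ˢ Metric.ball x₀ ρ₀,
              ENNReal.ofReal (Literature.Analysis.FluidPDE.frobeniusNormSq (fderiv ℝ (u z.1) z.2))
                / ‖z.2 - x₀‖ₑ < ⊤) :=
  fun _ν hν _T hT _u _p hsm hsw hloc x₀ =>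
    isBoundedNearTop_iff_exists_hardyDissipation_lt_top hν hT hsm hsw hloc x₀

end Summit.NavierStokesRegularity.NavierStokesRegularity.Theorems

end
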